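import Literature.NumberTheory.LFunctions.EulerMaclaurinZetaHigher
import Mathlib.NumberTheory.Harmonic.ZetaAsymp
import Mathlib.Analysis.Complex.Liouville
import Mathlib.Analysis.Calculus.IteratedDeriv.Lemmas
import Mathlib.Analysis.SpecialFunctions.ExpDeriv
import Mathlib.Algebra.Polynomial.Eval.Degree
import Mathlib.Algebra.Polynomial.BigOperators
import HarnessLib

/-!
# Taylor coefficients of `ζ₁(s) = (s−1)ζ(s)` at `s = 1` by Euler–Maclaurin and Cauchy's estimate

For the kernel certificate refuting [Xiao2020, Conj. 3.4] (`Xiao2020/Certificate.lean`) we need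
rigorous enclosures of `u_i = ζ₁^{(i)}(1)/i!` for `i ≤ 119` (equivalently of the Stieltjes
constants). Writing `s = 1 + w`, the order-`ν` Euler–Maclaurin formula
(`riemannZeta_eq_eulerMaclaurin_of_re_pos`, [Edwards1974, §6.4]) multiplied by `w` reads
`ζ₁(1+w) = P(w) + w·R_ν(1+w)` with the *exponential polynomial*
`P(w) = Σ_{n<N} n⁻¹ w e^{−w log n} + e^{−w log N} + w e^{−w log N}/(2N)
        + Σ_{k≤ν} (B_{2k}/(2k)!) N^{−2k} w (1+w)(2+w)⋯(2k−1+w) e^{−w log N}`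
(`emMainOne`), whose Taylor coefficients at `0` are explicit (`emMainOneCoeff`,
`iteratedDeriv_emMainOne_zero`), and the entire error `E = ζ₁(1+·) − P` is bounded on the circle
`|w| = r < 1` by `r · B` with the rational `B = emTailBound N ν r` (`norm_emRemHigher_le_rat`).
Cauchy's estimate then gives the main result `norm_zetaOneTaylor_sub_emMainOneCoeff_le`:
`|u_i − [wⁱ]P| ≤ r·B/rⁱ`.

[cite: Xiao2020, Conj. 3.4] [cite: Edwards1974, §6.4] [cite: Keiper1992, §2]
-/

open Complex Finset Filter Topology Metric Polynomial
open scoped Nat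
open Literature.NumberTheory.LFunctions

namespace Literature.NumberTheory.LFunctions.Xiao2020

/-! ## Exponential monomials `wˡ e^{cw}` and their Taylor coefficients -/

/-- `[wⁱ](wˡ e^{cw}) = c^{i−l}/(i−l)!` (`0` if `i < l`). [folklore] -/
noncomputable def expMonCoeff (l : ℕ) (c : ℂ) (i : ℕ) : ℂ :=
  if l ≤ i then c ^ (i - l) / ((i - l)! : ℂ) else 0

/-- `wˡ e^{cw}` is smooth. [folklore] -/
theorem contDiff_pow_mul_cexp (l : ℕ) (c : ℂ) {n : WithTop ℕ∞} :
    ContDiff ℂ n (fun w : ℂ ↦ w ^ l * cexp (c * w)) :=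
  (contDiff_id.pow l).mul (contDiff_const.mul contDiff_id).cexp

/-- `dⁱ/dwⁱ (wˡ e^{cw}) |_{w=0} = i! · [wⁱ](wˡ e^{cw})`. [folklore] -/
theorem iteratedDeriv_pow_mul_cexp_zero (l i : ℕ) (c : ℂ) :
    iteratedDeriv i (fun w : ℂ ↦ w ^ l * cexp (c * w)) 0 = (i ! : ℂ) * expMonCoeff l c i := by
  have hp : ContDiffAt ℂ i (fun w : ℂ ↦ w ^ l) 0 := (contDiff_id.pow l).contDiffAt
  have he : ContDiffAt ℂ i (fun w : ℂ ↦ cexp (c * w)) 0 :=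
    ((contDiff_const.mul contDiff_id).cexp).contDiffAt
  rw [iteratedDeriv_fun_mul hp he]
  have hpow : ∀ m, iteratedDeriv m (fun w : ℂ ↦ w ^ l) 0 = if m = l then (l ! : ℂ) else 0 :=
    fun m ↦ by rw [iteratedDeriv_fun_pow_zero]; split_ifs <;> simp
  have hexp : ∀ m, iteratedDeriv m (fun w : ℂ ↦ cexp (c * w)) 0 = c ^ m := fun m ↦ by
    rw [iteratedDeriv_cexp_const_mul]
    simp
  simp_rw [hpow, hexp]
  simp only [mul_ite, mul_zero, ite_mul, zero_mul, sum_ite_eq', mem_range]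
  unfold expMonCoeff
  by_cases hl : l ≤ i
  · rw [if_pos (Nat.lt_succ_of_le hl), if_pos hl]
    have h := Nat.choose_mul_factorial_mul_factorial hl
    have hne : ((i - l)! : ℂ) ≠ 0 := by exact_mod_cast Nat.factorial_ne_zero _
    rw [← h]
    push_cast
    field_simp
  · rw [if_neg (by omega), if_neg hl, mul_zero]

/-- Linear combinations of exponential monomials are smooth. [folklore] -/
theorem contDiff_sum_expMon {ι : Type*} (s : Finset ι) (b : ι → ℂ) (l : ι → ℕ) (c : ι → ℂ)
    {n : WithTop ℕ∞} :
    ContDiff ℂ n (fun w : ℂ ↦ ∑ j ∈ s, b j * (w ^ l j * cexp (c j * w))) :=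
  ContDiff.sum fun _ _ ↦ contDiff_const.mul (contDiff_pow_mul_cexp _ _)

/-- Taylor coefficients of a linear combination of exponential monomials. [folklore] -/
theorem iteratedDeriv_sum_expMon_zero {ι : Type*} (s : Finset ι) (b : ι → ℂ) (l : ι → ℕ)
    (c : ι → ℂ) (i : ℕ) :
    iteratedDeriv i (fun w : ℂ ↦ ∑ j ∈ s, b j * (w ^ l j * cexp (c j * w))) 0 =
      (i ! : ℂ) * ∑ j ∈ s, b j * expMonCoeff (l j) (c j) i := by
  rw [iteratedDeriv_fun_sum (fun j _ ↦ (contDiff_const.mul (contDiff_pow_mul_cexp _ _)).contDiffAt)]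
  rw [mul_sum]
  refine sum_congr rfl fun j _ ↦ ?_
  rw [iteratedDeriv_const_mul_field, iteratedDeriv_pow_mul_cexp_zero]
  ring

/-! ## The rising factorial `(1+w)(2+w)⋯(m+w)` as a polynomial in `w` -/

/-- Coefficients of `(1+w)(2+w)⋯(m+w) = Σ_l pochCoeff m l · wˡ` (unsigned Stirling numbers of the
first kind of `m+1`, shifted), by the recursion `c(m+1,l) = (m+1)c(m,l) + c(m,l−1)`. [folklore] -/
def pochCoeff : ℕ → ℕ → ℕ
  | 0, 0 => 1
  | 0, _ + 1 => 0
  | m + 1, 0 => (m + 1) * pochCoeff m 0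
  | m + 1, l + 1 => (m + 1) * pochCoeff m (l + 1) + pochCoeff m l

/-- The polynomial `(X+1)(X+2)⋯(X+m)`. [folklore] -/
noncomputable def pochPoly (m : ℕ) : Polynomial ℂ := ∏ j ∈ range m, (X + C ((j : ℂ) + 1))

/-- [folklore] -/
theorem pochPoly_succ (m : ℕ) : pochPoly (m + 1) = pochPoly m * (X + C ((m : ℂ) + 1)) := by
  rw [pochPoly, prod_range_succ, ← pochPoly]

/-- `pochCoeff` are the coefficients of `pochPoly`. [folklore] -/
theorem pochPoly_coeff : ∀ m l : ℕ, (pochPoly m).coeff l = (pochCoeff m l : ℂ)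
  | 0, 0 => by simp [pochPoly, pochCoeff]
  | 0, l + 1 => by simp [pochPoly, pochCoeff, coeff_one]
  | m + 1, 0 => by
    rw [pochPoly_succ, mul_coeff_zero, pochPoly_coeff m 0, pochCoeff]
    simp
    ring
  | m + 1, l + 1 => by
    rw [pochPoly_succ, mul_add, coeff_add, coeff_mul_X, coeff_mul_C, pochPoly_coeff m l,
      pochPoly_coeff m (l + 1), pochCoeff]
    push_cast
    ring

/-- [folklore] -/
theorem natDegree_pochPoly_le (m : ℕ) : (pochPoly m).natDegree ≤ m := by
  unfold pochPoly
  calc (∏ j ∈ range m, (X + C ((j : ℂ) + 1))).natDegree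
      ≤ ∑ j ∈ range m, (X + C ((j : ℂ) + 1)).natDegree := natDegree_prod_le _ _
    _ = ∑ j ∈ range m, 1 := sum_congr rfl fun j _ ↦ natDegree_X_add_C _
    _ = m := by simp

/-- `(1+w)(1+w+1)⋯(1+w+m−1) = Σ_{l≤m} pochCoeff m l · wˡ`. [folklore] -/
theorem emPoch_one_add (w : ℂ) (m : ℕ) :
    emPoch (1 + w) m = ∑ l ∈ range (m + 1), (pochCoeff m l : ℂ) * w ^ l := by
  have h1 : emPoch (1 + w) m = (pochPoly m).eval w := by
    rw [pochPoly, eval_prod, emPoch]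
    refine prod_congr rfl fun j _ ↦ ?_
    simp only [eval_add, eval_X, eval_C]
    ring
  rw [h1, eval_eq_sum_range' (Nat.lt_succ_of_le (natDegree_pochPoly_le m))]
  simp_rw [pochPoly_coeff]

/-! ## The exponential polynomial `P` and its Taylor coefficients -/

/-- `P_{N,ν}(w)`: `w` times the Euler–Maclaurin main terms of order `ν` for `ζ(1+w)`, written as a
combination of exponential monomials `wˡ e^{−w log n}`. [cite: Edwards1974, §6.4] -/
noncomputable def emMainOne (N ν : ℕ) (w : ℂ) : ℂ :=
  (∑ n ∈ Ico 1 N, (n : ℂ)⁻¹ * (w ^ 1 * cexp (-(Real.log n : ℂ) * w))) +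
  (w ^ 0 * cexp (-(Real.log N : ℂ) * w)) +
  ((2 * N : ℂ)⁻¹ * (w ^ 1 * cexp (-(Real.log N : ℂ) * w))) +
  ∑ p ∈ (Icc 1 ν).sigma (fun k ↦ range (2 * k)),
    ((bernoulli (2 * p.1) : ℂ) / (2 * p.1)! * ((N : ℂ) ^ (2 * p.1))⁻¹ * (pochCoeff (2 * p.1 - 1) p.2 : ℂ)) *
      (w ^ (p.2 + 1) * cexp (-(Real.log N : ℂ) * w))

/-- `[wⁱ] P_{N,ν}(w)`. [cite: Edwards1974, §6.4] -/
noncomputable def emMainOneCoeff (N ν i : ℕ) : ℂ :=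
  (∑ n ∈ Ico 1 N, (n : ℂ)⁻¹ * expMonCoeff 1 (-(Real.log n : ℂ)) i) +
  expMonCoeff 0 (-(Real.log N : ℂ)) i +
  (2 * N : ℂ)⁻¹ * expMonCoeff 1 (-(Real.log N : ℂ)) i +
  ∑ p ∈ (Icc 1 ν).sigma (fun k ↦ range (2 * k)),
    ((bernoulli (2 * p.1) : ℂ) / (2 * p.1)! * ((N : ℂ) ^ (2 * p.1))⁻¹ * (pochCoeff (2 * p.1 - 1) p.2 : ℂ)) *
      expMonCoeff (p.2 + 1) (-(Real.log N : ℂ)) i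

/-- `P_{N,ν}` is entire (smooth). [folklore] -/
theorem contDiff_emMainOne (N ν : ℕ) {n : WithTop ℕ∞} : ContDiff ℂ n (emMainOne N ν) := by
  unfold emMainOne
  refine (((contDiff_sum_expMon _ _ _ _).add (contDiff_pow_mul_cexp _ _)).add
    (contDiff_const.mul (contDiff_pow_mul_cexp _ _))).add (contDiff_sum_expMon _ _ _ _)

/-- **Taylor coefficients of `P_{N,ν}` at `0`.** [folklore] -/
theorem iteratedDeriv_emMainOne_zero (N ν i : ℕ) :
    iteratedDeriv i (emMainOne N ν) 0 = (i ! : ℂ) * emMainOneCoeff N ν i := by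
  have hA : ContDiffAt ℂ i (fun w : ℂ ↦ ∑ n ∈ Ico 1 N,
      (n : ℂ)⁻¹ * (w ^ 1 * cexp (-(Real.log n : ℂ) * w))) 0 :=
    (contDiff_sum_expMon _ _ _ _).contDiffAt
  have hB : ContDiffAt ℂ i (fun w : ℂ ↦ w ^ 0 * cexp (-(Real.log N : ℂ) * w)) 0 :=
    (contDiff_pow_mul_cexp _ _).contDiffAt
  have hC : ContDiffAt ℂ i (fun w : ℂ ↦ (2 * N : ℂ)⁻¹ * (w ^ 1 * cexp (-(Real.log N : ℂ) * w))) 0 :=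
    (contDiff_const.mul (contDiff_pow_mul_cexp _ _)).contDiffAt
  have hD : ContDiffAt ℂ i (fun w : ℂ ↦ ∑ p ∈ (Icc 1 ν).sigma (fun k ↦ range (2 * k)),
      ((bernoulli (2 * p.1) : ℂ) / (2 * p.1)! * ((N : ℂ) ^ (2 * p.1))⁻¹ *
        (pochCoeff (2 * p.1 - 1) p.2 : ℂ)) * (w ^ (p.2 + 1) * cexp (-(Real.log N : ℂ) * w))) 0 :=
    (contDiff_sum_expMon _ _ _ _).contDiffAt
  unfold emMainOne emMainOneCoeff
  rw [iteratedDeriv_fun_add ((hA.add hB).add hC) hD, iteratedDeriv_fun_add (hA.add hB) hC,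
    iteratedDeriv_fun_add hA hB, iteratedDeriv_sum_expMon_zero, iteratedDeriv_pow_mul_cexp_zero,
    iteratedDeriv_const_mul_field, iteratedDeriv_pow_mul_cexp_zero, iteratedDeriv_sum_expMon_zero]
  ring

/-! ## `ζ₁(1+w) = P(w) + w·R_ν(1+w)` -/

/-- `n^{−(a+w)} = n^{−a} e^{−w log n}` for natural `n ≥ 1`, `a`. [folklore] -/
theorem natCast_cpow_neg_natCast_add {n : ℕ} (hn : 1 ≤ n) (a : ℕ) (w : ℂ) :
    (n : ℂ) ^ (-((a : ℂ) + w)) = ((n : ℂ) ^ a)⁻¹ * cexp (-(Real.log n : ℂ) * w) := by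
  have hn0 : (n : ℂ) ≠ 0 := by exact_mod_cast (show n ≠ 0 by omega)
  have hnpos : (0 : ℝ) < n := by exact_mod_cast hn
  rw [cpow_def_of_ne_zero hn0, ← natCast_log,
    show (Real.log n : ℂ) * -((a : ℂ) + w) = -((a : ℂ) * (Real.log n : ℂ)) + -(Real.log n : ℂ) * w
      by ring,
    Complex.exp_add, Complex.exp_neg, Complex.exp_nat_mul, ← Complex.ofReal_exp,
    Real.exp_log hnpos, Complex.ofReal_natCast]

/-- **Euler–Maclaurin for `ζ₁` at `s = 1 + w`**: `ζ₁(1+w) = P_{N,ν}(w) + w·R_ν(1+w)` for `w ≠ 0`,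
`Re w > −1`. [cite: Edwards1974, §6.4] -/
theorem riemannZeta₁_one_add_eq_emMainOne {N : ℕ} (hN : 1 ≤ N) (ν : ℕ) {w : ℂ} (hw : w ≠ 0)
    (hre : 0 < (1 + w).re) :
    riemannZeta₁ (1 + w) = emMainOne N ν w + w * emRemHigher N ν (1 + w) := by
  have h1 : (1 : ℂ) + w ≠ 1 := fun h ↦ hw (by linear_combination h)
  -- `ζ₁(1+w) = w ζ(1+w)` (also `Literature.NumberTheory.Sieve.GPY.riemannZeta₁_one_add`)
  have hζ₁ : riemannZeta₁ (1 + w) = w * riemannZeta (1 + w) := by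
    rw [riemannZeta_eq_inv_sub_mul h1, add_sub_cancel_left, ← mul_assoc, mul_inv_cancel₀ hw,
      one_mul]
  rw [hζ₁, riemannZeta_eq_eulerMaclaurin_of_re_pos hN hre h1 ν]
  have hN0 : (N : ℂ) ≠ 0 := by exact_mod_cast (show N ≠ 0 by omega)
  -- the pieces of `w · emMainZero N (1+w)`
  have hn : ∀ n ∈ Ico 1 N, w * (n : ℂ) ^ (-(1 + w)) =
      (n : ℂ)⁻¹ * (w ^ 1 * cexp (-(Real.log n : ℂ) * w)) := by
    intro n hn
    have := natCast_cpow_neg_natCast_add (n := n) (mem_Ico.1 hn).1 1 w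
    rw [Nat.cast_one, pow_one] at this
    rw [this]
    ring
  have hN1 : w * ((N : ℂ) ^ (1 - (1 + w)) / (1 + w - 1)) = w ^ 0 * cexp (-(Real.log N : ℂ) * w) := by
    have := natCast_cpow_neg_natCast_add (n := N) hN 0 w
    rw [Nat.cast_zero, pow_zero, zero_add] at this
    rw [show (1 : ℂ) - (1 + w) = -w by ring, this, show (1 : ℂ) + w - 1 = w by ring]
    field_simp
  have hN2 : w * ((N : ℂ) ^ (-(1 + w)) / 2) =
      (2 * N : ℂ)⁻¹ * (w ^ 1 * cexp (-(Real.log N : ℂ) * w)) := by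
    have := natCast_cpow_neg_natCast_add (n := N) hN 1 w
    rw [Nat.cast_one, pow_one] at this
    rw [this]
    field_simp
  -- the Bernoulli terms
  have hT : ∀ k ∈ Icc 1 ν, w * emTerm N (1 + w) k =
      ∑ l ∈ range (2 * k), ((bernoulli (2 * k) : ℂ) / (2 * k)! * ((N : ℂ) ^ (2 * k))⁻¹ *
        (pochCoeff (2 * k - 1) l : ℂ)) * (w ^ (l + 1) * cexp (-(Real.log N : ℂ) * w)) := by
    intro k hk
    have hk1 : 1 ≤ k := (mem_Icc.1 hk).1
    have hexp : (N : ℂ) ^ (-((1 + w) + ((2 * k - 1 : ℕ) : ℂ))) =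
        ((N : ℂ) ^ (2 * k))⁻¹ * cexp (-(Real.log N : ℂ) * w) := by
      have := natCast_cpow_neg_natCast_add (n := N) hN (2 * k) w
      rw [← this]
      congr 1
      rw [Nat.cast_sub (by omega)]
      push_cast
      ring
    have hP := emPoch_one_add w (2 * k - 1)
    rw [show 2 * k - 1 + 1 = 2 * k by omega] at hP
    rw [emTerm, hexp, hP]
    simp_rw [mul_sum, sum_mul, mul_sum]
    refine sum_congr rfl fun l _ ↦ ?_
    ring
  unfold emMainOne emMainZero
  rw [sum_sigma, mul_add, mul_add, mul_add, mul_add, mul_sum, mul_sum, sum_congr rfl hn, hN1, hN2,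
    sum_congr rfl hT]

/-! ## The Cauchy estimate -/

/-- The sphere bound `B = Π_{j≤2ν}(1+j+r) · (33/10)(25/157)^{2ν+1} / (N^{2ν}·2ν)` for
`|R_ν(1+w)|` on `|w| = r`. [cite: Edwards1974, §6.4] -/
noncomputable def emTailBound (N ν : ℕ) (r : ℝ) : ℝ :=
  (∏ j ∈ range (2 * ν + 1), (1 + j + r)) * ((33 / 10 : ℝ) * (25 / 157) ^ (2 * ν + 1)) *
    (1 / ((N : ℝ) ^ (2 * ν) * (2 * ν)))

/-- `|(1+w)(2+w)⋯| ≤ Π (1+j+r)` for `|w| ≤ r`. [folklore] -/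
theorem norm_emPoch_one_add_le {w : ℂ} {r : ℝ} (hw : ‖w‖ ≤ r) (m : ℕ) :
    ‖emPoch (1 + w) m‖ ≤ ∏ j ∈ range m, (1 + j + r) := by
  unfold emPoch
  rw [norm_prod]
  refine prod_le_prod (fun _ _ ↦ norm_nonneg _) fun j _ ↦ ?_
  calc ‖1 + w + (j : ℂ)‖ = ‖((1 + j : ℕ) : ℂ) + w‖ := by push_cast; ring_nf
    _ ≤ ‖((1 + j : ℕ) : ℂ)‖ + ‖w‖ := norm_add_le _ _
    _ ≤ 1 + j + r := by rw [Complex.norm_natCast]; push_cast; linarith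

/-- [folklore] -/
theorem emTailBound_nonneg (N ν : ℕ) {r : ℝ} (hr : 0 ≤ r) : 0 ≤ emTailBound N ν r := by
  unfold emTailBound
  refine mul_nonneg (mul_nonneg (prod_nonneg fun j _ ↦ by positivity) (by positivity)) ?_
  positivity

/-- On the circle `|w| = r` (`0 < r < 1`): `|ζ₁(1+w) − P(w)| ≤ r·B`. [cite: Edwards1974, §6.4] -/
theorem norm_riemannZeta₁_sub_emMainOne_le {N ν : ℕ} (hN : 1 ≤ N) (hν : ν ≠ 0) {r : ℝ}
    (hr0 : 0 < r) (hr1 : r < 1) {w : ℂ} (hw : ‖w‖ = r) :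
    ‖riemannZeta₁ (1 + w) - emMainOne N ν w‖ ≤ r * emTailBound N ν r := by
  have hw0 : w ≠ 0 := fun h ↦ by rw [h, norm_zero] at hw; exact hr0.ne' hw.symm
  have hre : 0 < (1 + w).re := by
    have := abs_re_le_norm w
    rw [add_re, one_re]
    have : |w.re| < 1 := by linarith
    linarith [neg_abs_le w.re]
  rw [riemannZeta₁_one_add_eq_emMainOne hN ν hw0 hre, add_sub_cancel_left, norm_mul, hw]
  refine mul_le_mul_of_nonneg_left ?_ hr0.le
  refine (norm_emRemHigher_le_rat hN hre hν).trans ?_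
  unfold emTailBound
  have hP := norm_emPoch_one_add_le hw.le (2 * ν + 1)
  have hN0 : (0 : ℝ) < N := by exact_mod_cast hN
  gcongr

/-- **Main result: enclosure of the Taylor coefficients of `ζ₁` at `1`.** For `N ≥ 1`, `ν ≥ 1`,
`0 < r < 1` and every `i`: `|ζ₁^{(i)}(1)/i! − [wⁱ]P_{N,ν}| ≤ r·B/rⁱ`.
[cite: Edwards1974, §6.4] [cite: Keiper1992, §2] -/
theorem norm_zetaOneTaylor_sub_emMainOneCoeff_le {N ν : ℕ} (hN : 1 ≤ N) (hν : ν ≠ 0) {r : ℝ}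
    (hr0 : 0 < r) (hr1 : r < 1) (i : ℕ) :
    ‖iteratedDeriv i riemannZeta₁ 1 / (i ! : ℂ) - emMainOneCoeff N ν i‖ ≤
      r * emTailBound N ν r / r ^ i := by
  set E : ℂ → ℂ := fun w ↦ riemannZeta₁ (1 + w) - emMainOne N ν w with hE
  have hZ : ContDiff ℂ i (fun w : ℂ ↦ riemannZeta₁ (1 + w)) :=
    differentiable_riemannZeta₁.contDiff.comp (contDiff_const.add contDiff_id)
  have hEdiff : Differentiable ℂ E :=
    (differentiable_riemannZeta₁.comp (differentiable_const _ |>.add differentiable_id)).sub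
      (contDiff_emMainOne N ν (n := 1)).differentiable_one
  have hDE : iteratedDeriv i E 0 = iteratedDeriv i riemannZeta₁ 1 - (i ! : ℂ) * emMainOneCoeff N ν i := by
    rw [hE, iteratedDeriv_fun_sub hZ.contDiffAt (contDiff_emMainOne N ν).contDiffAt,
      iteratedDeriv_comp_const_add i riemannZeta₁ 1, iteratedDeriv_emMainOne_zero]
    simp
  have hC := Complex.norm_iteratedDeriv_le_of_forall_mem_sphere_norm_le (f := E) (c := 0) i hr0
    hEdiff.diffContOnCl (fun z hz ↦ norm_riemannZeta₁_sub_emMainOne_le hN hν hr0 hr1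
      (by simpa using hz))
  rw [hDE] at hC
  have hfi : (0 : ℝ) < i ! := by exact_mod_cast Nat.factorial_pos i
  have hfi' : (i ! : ℂ) ≠ 0 := by exact_mod_cast Nat.factorial_ne_zero i
  have : iteratedDeriv i riemannZeta₁ 1 / (i ! : ℂ) - emMainOneCoeff N ν i =
      (iteratedDeriv i riemannZeta₁ 1 - (i ! : ℂ) * emMainOneCoeff N ν i) / (i ! : ℂ) := by
    field_simp
  rw [this, norm_div, Complex.norm_natCast, div_le_iff₀ hfi]
  calc ‖iteratedDeriv i riemannZeta₁ 1 - (i ! : ℂ) * emMainOneCoeff N ν i‖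
      ≤ i ! * (r * emTailBound N ν r) / r ^ i := hC
    _ = r * emTailBound N ν r / r ^ i * i ! := by ring

end Literature.NumberTheory.LFunctions.Xiao2020
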